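import Summits.QuantumAdvantage.QuantumAdvantage.Theorems.CubicForrelationSignedExactCubicForrelationInPrBPPDescent
import Literature.Computability.QuantumComplexity.CubicForrelationEstimatorAnalysis
import Literature.Computability.QuantumComplexity.MSubspaceSignReadoutRelaxedRuns

/-!
# Good pairs for the restrict/fold descent exist through EVERY direction (support item stmt-QuantumAdvantage-14671)

Route `CubicForrelation`, item `SignedExactCubicForrelationInPrBPP` (= `¬` crux r3). The landed descent
(`Theorems/CubicForrelationSignedExactCubicForrelationInPrBPPDescent.lean`: `descent_step`,
`forrelation_eq_after_one_step`) cuts an exactly forrelated pair `Φ(a,b) = ±1` on `n` bits down to `n - 2` bits,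
keeping the sign readable, as soon as a GOOD PAIR `(p₁, p₂)` — `D_{p₁} D_{p₂} a ≡ 1` — is supplied. This file
proves that good pairs are never the obstruction:

* `sum_signOf_derivative_eq_zero` — on an exact pair the function `a` is bent (`â(w)² = 1`, pointwise duality
  `base_invariant` applied to `(b, a)`), hence every derivative `D_p a`, `p ≠ 0`, is BALANCED
  (`autocorr_eq_sum_twist_mul_hat_sq`: the autocorrelation is the Fourier transform of `â²`);
* `exists_antiperiod_of_quadratic_balanced` — a balanced QUADRATIC `q` has an anti-period `d` in the radical of
  its polar form (`q(x ⊕ d) = q(x) ⊕ 1` for all `x`): otherwise Dickson's autocorrelation formula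
  (`QuadSampler.autoc_eq`) makes `(∑ (-1)^q)² = 2ⁿ · #{radical directions with ℓ = 0} ≥ 2ⁿ > 0`;
* `goodPair_iff` — for cubic `a`, `(p₁, p₂)` is good iff `p₂` lies in the radical of the polar form of the
  quadratic `D_{p₁} a` and `D_{p₁}a(p₂) ≠ D_{p₁}a(0)`: an AFFINE condition on a linear subspace, i.e. the partners
  of a given `p₁` are found by linear algebra over `𝔽₂` (`O(n²)` evaluations of `a`, one Gaussian elimination);
* `exists_goodPair` — hence for an exact pair with `a` of degree `≤ 3` EVERY `p₁ ≠ 0` has a good partner `p₂`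
  (no Maiorana–McFarland hypothesis, no crux r5, `b` arbitrary), and `exists_descent_step` packages the level-1
  readout `Φ(a,b) = (-1)^{fold(a)(0)} · sgn ∑_{x·p₁ = x·p₂ = 0} (-1)^{b x}` through any prescribed direction.

So hypothesis "DH" of the descent note (one good plane per level) holds unconditionally at every level at which the
folded side is still cubic; what remains open for the item is only the REPRESENTATION of the fold (degree growth
`3 → 4` off the radical of the cubic form), not the existence or the cost of finding the plane.

References: [AaronsonAmbainis2018] S. Aaronson, A. Ambainis, Forrelation, SIAM J. Comput. 47 (2018), §1.1.1;
[MacWilliamsSloane1977] Ch. 15 §2 (Dickson's theorem, radical of a quadratic form over `GF(2)`);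
[Carlet2020] C. Carlet, Boolean Functions for Cryptography and Coding Theory, CUP 2021, §2.2.2 (derivatives lower
the degree), §5.2 (quadratic functions: balanced iff non-constant on the kernel of the associated symplectic form),
§6.1 (bent functions: all derivatives `D_p f`, `p ≠ 0`, are balanced); [ODonnell2014] §1.4 (Fourier inversion).
-/

noncomputable section

set_option linter.dupNamespace false -- D-0017: single-problem summit ⇒ `QuantumAdvantage.QuantumAdvantage` by design

namespace Summit.QuantumAdvantage.QuantumAdvantage.Theorems.SignedExactCubicForrelationInPrBPP.Descent

open Finset
open Literature.Computability.QuantumComplexity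
open Literature.Computability.QuantumComplexity.BuzetChailloux (bxor zeroVec bxor_zeroVec zeroVec_bxor
  twist_bxor_right twist_zeroVec_right signOf_sq sum_twist_left hat hat_sq autocorr bxor_eq_zeroVec_iff)
open Literature.Computability.QuantumComplexity.QuadSampler (sgnZ sgnZ_add signOf_eq_sgnZ zmod2_eq_zero_or_one)
open Literature.Computability.QuantumComplexity.QuadPolar (toZFun toZFun_apply polar shift_add_eq_polar
  polar_zero_right polar_comm)
open Literature.Computability.Complexity.LowDegree (xorVec xorVec_apply)
open Literature.Computability.Complexity.BLR (toZ toZ_xor)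
open Literature.Computability.Complexity.F2Elim (dotZ dotZ_zero_left)

variable {n : ℕ}

/-! ### Fourier inversion for the autocorrelation, and bentness of `a` on an exact pair -/

/-- **The autocorrelation is the Fourier transform of `ĥ²`**: `C_h(p) = ∑_x (-1)^{x·p} ĥ(x)²` (inverse of the
Wiener–Khinchin formula `hat_sq`). [cite: ODonnell2014, §1.4] -/
theorem autocorr_eq_sum_twist_mul_hat_sq (h : (Fin n → Bool) → ℝ) (p : Fin n → Bool) :
    autocorr h p = ∑ x, twist x p * hat h x ^ 2 := by
  simp_rw [hat_sq, mul_sum, ← mul_assoc]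
  rw [sum_comm]
  have e : ∀ z : Fin n → Bool, ∑ x, twist x p * ((2 : ℝ) ^ n)⁻¹ * twist x z * autocorr h z =
      ((2 : ℝ) ^ n)⁻¹ * autocorr h z * (if bxor p z = zeroVec then (2 : ℝ) ^ n else 0) := by
    intro z
    rw [← sum_twist_left (bxor p z), mul_sum]
    refine sum_congr rfl fun x _ => ?_
    rw [twist_bxor_right]
    ring
  rw [sum_congr rfl fun z _ => e z]
  simp_rw [bxor_eq_zeroVec_iff, mul_ite, mul_zero, Finset.sum_ite_eq univ p, if_pos (mem_univ _)]
  field_simp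

/-- **On an exact pair, `a` is bent**: `Φ(a,b)² = 1` gives `â(w)² = 1` for every `w` (pointwise duality
`base_invariant` for the swapped pair `(b,a)`, `Φ(b,a) = Φ(a,b)`). [cite: AaronsonAmbainis2018, §1.1.1] -/
theorem hat_signOf_sq_eq_one {a b : (Fin n → Bool) → Bool} (h : forrelation a b ^ 2 = 1) (w : Fin n → Bool) :
    hat (fun x => signOf (a x)) w ^ 2 = 1 := by
  have h' : forrelation b a ^ 2 = 1 := by rw [MMReadout.forrelation_symm']; exact h
  have key := base_invariant b a h' w
  have hs : (0 : ℝ) < Real.sqrt ((2 : ℝ) ^ n) := Real.sqrt_pos.2 (by positivity)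
  have e : hat (fun x => signOf (a x)) w = forrelation b a * signOf (b w) := by
    unfold hat
    simp_rw [twist_comm w]
    have : ∑ y, twist y w * signOf (a y) = ∑ x, signOf (a x) * twist x w :=
      sum_congr rfl fun y _ => mul_comm _ _
    rw [this, key, ← mul_assoc, ← mul_assoc, inv_mul_cancel₀ hs.ne', one_mul]
  rw [e, mul_pow, h', signOf_sq, mul_one]

/-- **Every derivative of the bent side is balanced**: on an exact pair `Φ(a,b)² = 1`, for every `p ≠ 0`,
`∑_x (-1)^{a(x) ⊕ a(x ⊕ p)} = 0` (the autocorrelation of `(-1)^a` is `2ⁿ δ₀`). [cite: Carlet2020, §6.1] -/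
theorem sum_signOf_derivative_eq_zero {a b : (Fin n → Bool) → Bool} (h : forrelation a b ^ 2 = 1)
    {p : Fin n → Bool} (hp : p ≠ zeroVec) : ∑ x, signOf (a x ^^ a (bxor x p)) = 0 := by
  have key := autocorr_eq_sum_twist_mul_hat_sq (fun x => signOf (a x)) p
  simp_rw [hat_signOf_sq_eq_one h, mul_one, sum_twist_left, if_neg hp] at key
  rw [← key, autocorr]
  exact sum_congr rfl fun x _ => CubicDequant.signOf_xor _ _

/-! ### A balanced quadratic has an anti-period in its radical -/

/-- The shift identity of a quadratic in radical directions: if `B d = 0` then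
`[q(x ⊕ d)] + [q(x)] = ℓ(d)` for every `x`. [cite: MacWilliamsSloane1977, Ch. 15 §2] -/
theorem toZFun_shift_add_of_Bd_eq_zero {q : (Fin n → Bool) → Bool} (hq : toZFun q ∈ CHHL2018.lowDeg n 2)
    {d : Fin n → Bool} (hd : QuadSampler.Bd q d = 0) (x : Fin n → Bool) :
    toZFun q (xorVec x d) + toZFun q x = QuadSampler.ell q d := by
  rw [shift_add_eq_polar, QuadSampler.polar_eq_dotZ hq, hd, dotZ_zero_left, zero_add]
  rfl

/-- An anti-period read in Booleans: `[q(x ⊕ d)] + [q x] = 1` for all `x` iff `q x ⊕ q(x ⊕ d) = 1` for all `x`.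
[folklore] -/
theorem xor_shift_eq_true_iff (q : (Fin n → Bool) → Bool) (d x : Fin n → Bool) :
    (q x ^^ q (xorVec x d)) = true ↔ toZFun q (xorVec x d) + toZFun q x = 1 := by
  rw [toZFun_apply, toZFun_apply, ← toZ_xor]
  cases q (xorVec x d) <;> cases q x <;> decide

/-- **Radical directions with `ℓ = 1` are anti-periods**: if `B d = 0` and `ℓ(d) = 1` then `q(x ⊕ d) = q(x) ⊕ 1`
for every `x`. [cite: MacWilliamsSloane1977, Ch. 15 §2] -/
theorem antiperiod_of_Bd_eq_zero_of_ell {q : (Fin n → Bool) → Bool} (hq : toZFun q ∈ CHHL2018.lowDeg n 2)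
    {d : Fin n → Bool} (hd : QuadSampler.Bd q d = 0) (hl : QuadSampler.ell q d = 1) (x : Fin n → Bool) :
    (q x ^^ q (xorVec x d)) = true := by
  rw [xor_shift_eq_true_iff, toZFun_shift_add_of_Bd_eq_zero hq hd, hl]

/-- **A balanced quadratic has an anti-period in the radical of its polar form.** If `q : {0,1}ⁿ → {0,1}` has
degree `≤ 2` and `∑_x (-1)^{q(x)} = 0`, then some `d` with `B d = 0` satisfies `q(x ⊕ d) = q(x) ⊕ 1` for all `x`
(and then necessarily `d ≠ 0`). Proof: by Dickson's autocorrelation formula `A(d) = (-1)^{ℓ(d)} 2ⁿ [B d = 0]`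
(`QuadSampler.autoc_eq`) and `W(0)² = ∑_d A(d)`, if every radical direction had `ℓ(d) = 0` the square of the
(vanishing) sum would be `2ⁿ · |rad| ≥ 2ⁿ`. [cite: MacWilliamsSloane1977, Ch. 15 §2] [cite: Carlet2020, §5.2] -/
theorem exists_antiperiod_of_quadratic_balanced {q : (Fin n → Bool) → Bool}
    (hq : toZFun q ∈ CHHL2018.lowDeg n 2) (hbal : ∑ x, signOf (q x) = 0) :
    ∃ d : Fin n → Bool, QuadSampler.Bd q d = 0 ∧ ∀ x, (q x ^^ q (xorVec x d)) = true := by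
  by_contra hcon
  push Not at hcon
  -- every radical direction has `ℓ = 0`
  have hell : ∀ d, QuadSampler.Bd q d = 0 → QuadSampler.ell q d = 0 := by
    intro d hd
    rcases zmod2_eq_zero_or_one (QuadSampler.ell q d) with h0 | h1
    · exact h0
    · obtain ⟨x, hx⟩ := hcon d hd
      exact absurd (antiperiod_of_Bd_eq_zero_of_ell hq hd h1 x) hx
  -- the Walsh coefficient at `0` is the plain sum, which vanishes
  have hW : QuadSampler.walsh q QuadSampler.zeroV = 0 := by
    rw [← hbal, QuadSampler.walsh]
    refine sum_congr rfl fun x _ => ?_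
    rw [twist_comm, show (QuadSampler.zeroV : Fin n → Bool) = zeroVec from rfl, twist_zeroVec_right, mul_one,
      toZFun_apply, ← signOf_eq_sgnZ]
  -- its square is the sum of the autocorrelations, all `≥ 0`, the one at `d = 0` being `2ⁿ`
  have hsq : (0 : ℝ) = ∑ d, QuadSampler.autoc q d := by
    have := QuadSampler.walsh_sq (q := q) QuadSampler.zeroV
    rw [hW] at this
    simp_rw [show (QuadSampler.zeroV : Fin n → Bool) = zeroVec from rfl] at this
    calc (0 : ℝ) = 0 ^ 2 := by norm_num
      _ = ∑ x, twist zeroVec x * QuadSampler.autoc q x := this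
      _ = ∑ d, QuadSampler.autoc q d := by
          refine sum_congr rfl fun d _ => ?_
          rw [twist_comm, twist_zeroVec_right, one_mul]
  have hnonneg : ∀ d ∈ (univ : Finset (Fin n → Bool)), (0 : ℝ) ≤ QuadSampler.autoc q d := by
    intro d _
    rw [QuadSampler.autoc_eq hq]
    split_ifs with hd
    · rw [hell d hd, QuadSampler.sgnZ_zero, one_mul]; positivity
    · rw [mul_zero]
  have h0 : QuadSampler.autoc q QuadSampler.zeroV = (2 : ℝ) ^ n := by
    rw [QuadSampler.autoc_eq hq, QuadSampler.Bd_zeroV, if_pos rfl, QuadSampler.ell_zeroV, QuadSampler.sgnZ_zero,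
      one_mul]
  have hle := single_le_sum hnonneg (mem_univ (QuadSampler.zeroV : Fin n → Bool))
  rw [h0, ← hsq] at hle
  have : (0 : ℝ) < (2 : ℝ) ^ n := by positivity
  linarith

/-! ### Good pairs of a cubic: characterisation and existence -/

/-- `(x ⊕ p₂) ⊕ p₁ = x ⊕ (p₁ ⊕ p₂)`. [folklore] -/
theorem xorVec_xorVec_eq_bxor_bxor (x p₁ p₂ : Fin n → Bool) :
    xorVec (xorVec x p₂) p₁ = bxor x (bxor p₁ p₂) := by
  funext i
  simp only [xorVec_apply]
  show ((x i ^^ p₂ i) ^^ p₁ i) = (x i ^^ (p₁ i ^^ p₂ i))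
  cases x i <;> cases p₁ i <;> cases p₂ i <;> rfl

/-- The second difference `D_{p₁}D_{p₂} a (w)` is the derivative in direction `p₂` of the Boolean derivative
`D_{p₁} a = CubicDequant.Df a p₁`. [cite: Carlet2020, §2.2.2] -/
theorem secondDiff_eq_Df_shift (a : (Fin n → Bool) → Bool) (p₁ p₂ w : Fin n → Bool) :
    (a w ^^ a (bxor w p₁) ^^ a (bxor w p₂) ^^ a (bxor w (bxor p₁ p₂))) =
      (CubicDequant.Df a p₁ w ^^ CubicDequant.Df a p₁ (xorVec w p₂)) := by
  rw [← xorVec_xorVec_eq_bxor_bxor]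
  show (a w ^^ a (xorVec w p₁) ^^ a (xorVec w p₂) ^^ a (xorVec (xorVec w p₂) p₁)) =
    ((a w ^^ a (xorVec w p₁)) ^^ (a (xorVec w p₂) ^^ a (xorVec (xorVec w p₂) p₁)))
  cases a w <;> cases a (xorVec w p₁) <;> cases a (xorVec w p₂) <;> cases a (xorVec (xorVec w p₂) p₁) <;> rfl

/-- **Good pairs are linear algebra.** For `a` of degree `≤ 3` and any `p₁`, a vector `p₂` completes a good pair
(`D_{p₁}D_{p₂} a ≡ 1`) iff `p₂` lies in the radical of the polar form of the quadratic `q = D_{p₁} a`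
(`B_q p₂ = 0`) and `ℓ_q(p₂) = q(p₂) ⊕ q(0) = 1`: an affine hyperplane section of a linear subspace, computed from the
`O(n²)` values `q(0), q(eᵢ), q(eᵢ ⊕ eⱼ)`. [cite: MacWilliamsSloane1977, Ch. 15 §2] [cite: Carlet2020, §5.2] -/
theorem goodPair_iff {a : (Fin n → Bool) → Bool} (ha : IsDegLeFun 3 a) (p₁ p₂ : Fin n → Bool) :
    (∀ w, (a w ^^ a (bxor w p₁) ^^ a (bxor w p₂) ^^ a (bxor w (bxor p₁ p₂))) = true) ↔
      QuadSampler.Bd (CubicDequant.Df a p₁) p₂ = 0 ∧ QuadSampler.ell (CubicDequant.Df a p₁) p₂ = 1 := by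
  have hq := CubicDequant.Df_quadratic ha p₁
  simp_rw [secondDiff_eq_Df_shift, xor_shift_eq_true_iff]
  constructor
  · intro H
    -- at `w = 0` the polar term vanishes, so `ℓ = 1`
    have hl : QuadSampler.ell (CubicDequant.Df a p₁) p₂ = 1 := by
      have h0 := H QuadSampler.zeroV
      rw [shift_add_eq_polar, polar_comm, show (QuadSampler.zeroV : Fin n → Bool) = (fun _ => false) from rfl,
        polar_zero_right, zero_add] at h0
      exact h0
    refine ⟨?_, hl⟩
    -- then `B(x, p₂) = 0` for every `x`, in particular at the unit vectors
    funext i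
    have hx := H (QuadSampler.ev i)
    rw [shift_add_eq_polar] at hx
    have : polar (toZFun (CubicDequant.Df a p₁)) (QuadSampler.ev i) p₂ + QuadSampler.ell (CubicDequant.Df a p₁) p₂ = 1 := by
      unfold QuadSampler.ell
      rw [← add_assoc]
      exact hx
    rw [hl] at this
    show polar (toZFun (CubicDequant.Df a p₁)) (QuadSampler.ev i) p₂ = 0
    linear_combination this
  · rintro ⟨hB, hl⟩ w
    rw [toZFun_shift_add_of_Bd_eq_zero hq hB, hl]

/-- **Good pairs exist through every direction.** On an exactly forrelated pair (`Φ(a,b) = ±1`) with `a` of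
degree `≤ 3`, every `p₁ ≠ 0` has a partner `p₂` with `D_{p₁}D_{p₂} a ≡ 1`: `D_{p₁} a` is a balanced
(`sum_signOf_derivative_eq_zero`) quadratic (`CubicDequant.Df_quadratic`), so it has an anti-period
(`exists_antiperiod_of_quadratic_balanced`). No hypothesis on `b`, no Maiorana–McFarland shape, no crux r5.
[cite: Carlet2020, §6.1 and §5.2] -/
theorem exists_goodPair {a b : (Fin n → Bool) → Bool} (hΦ : forrelation a b = 1 ∨ forrelation a b = -1)
    (ha : IsDegLeFun 3 a) {p₁ : Fin n → Bool} (hp₁ : p₁ ≠ zeroVec) :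
    ∃ p₂ : Fin n → Bool, ∀ w, (a w ^^ a (bxor w p₁) ^^ a (bxor w p₂) ^^ a (bxor w (bxor p₁ p₂))) = true := by
  have hsq : forrelation a b ^ 2 = 1 := by rcases hΦ with h | h <;> rw [h] <;> norm_num
  have hbal : ∑ x, signOf (CubicDequant.Df a p₁ x) = 0 := sum_signOf_derivative_eq_zero hsq hp₁
  obtain ⟨d, -, hd⟩ := exists_antiperiod_of_quadratic_balanced (CubicDequant.Df_quadratic ha p₁) hbal
  exact ⟨d, fun w => by rw [secondDiff_eq_Df_shift]; exact hd w⟩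

/-- **The descent runs through any prescribed direction.** For an exact pair with `a` of degree `≤ 3` and any
`p₁ ≠ 0` there is `p₂` such that `(p₁, p₂)` is a good pair AND the level-1 readout of the landed descent holds:
`Φ(a,b) = (-1)^{a(0) ⊕ (D_{p₁}a(0) ∧ D_{p₂}a(0))} · sgn ∑_{x·p₁ = x·p₂ = 0} (-1)^{b x}`
(`forrelation_eq_after_one_step`). [cite: AaronsonAmbainis2018, §1.1.1] [cite: Carlet2020, §6.1] -/
theorem exists_descent_step {a b : (Fin n → Bool) → Bool} (hΦ : forrelation a b = 1 ∨ forrelation a b = -1)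
    (ha : IsDegLeFun 3 a) {p₁ : Fin n → Bool} (hp₁ : p₁ ≠ zeroVec) :
    ∃ p₂ : Fin n → Bool,
      (∀ w, (a w ^^ a (bxor w p₁) ^^ a (bxor w p₂) ^^ a (bxor w (bxor p₁ p₂))) = true) ∧
      forrelation a b =
        signOf (a zeroVec ^^ ((a zeroVec ^^ a p₁) && (a zeroVec ^^ a p₂))) *
          (if 0 < ∑ x ∈ (univ : Finset (Fin n → Bool)).filter (fun x => twist x p₁ = 1 ∧ twist x p₂ = 1),
              signOf (b x) then 1 else -1) := by
  obtain ⟨p₂, hD⟩ := exists_goodPair hΦ ha hp₁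
  exact ⟨p₂, hD, forrelation_eq_after_one_step a b hΦ p₁ p₂ hD⟩

/-- **Symmetric form** (good pairs for `b`): on an exact pair the roles of `a` and `b` swap (`Φ(b,a) = Φ(a,b)`), so
if `b` has degree `≤ 3` every `p₁ ≠ 0` has a partner with `D_{p₁}D_{p₂} b ≡ 1` as well — the step that restricts
`a` and folds `b`. [cite: Carlet2020, §6.1] -/
theorem exists_goodPair_right {a b : (Fin n → Bool) → Bool} (hΦ : forrelation a b = 1 ∨ forrelation a b = -1)
    (hb : IsDegLeFun 3 b) {p₁ : Fin n → Bool} (hp₁ : p₁ ≠ zeroVec) :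
    ∃ p₂ : Fin n → Bool, ∀ w, (b w ^^ b (bxor w p₁) ^^ b (bxor w p₂) ^^ b (bxor w (bxor p₁ p₂))) = true := by
  refine exists_goodPair (b := a) ?_ hb hp₁
  rw [MMReadout.forrelation_symm']; exact hΦ

end Summit.QuantumAdvantage.QuantumAdvantage.Theorems.SignedExactCubicForrelationInPrBPP.Descent

end
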